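import Summits.QuantumFields.YangMills.Theorems.UnitScaleTiltHalvingP1FlatCoreTopStepTorusTraceFree
import Summits.QuantumFields.YangMills.Theorems.UnitScaleTiltHalvingP1FlatCoreSupplierLowerFamily
import Literature.MathematicalPhysics.QuantumFieldTheory.Balaban1983to89.B8SockHFPTraceFree
import Literature.MathematicalPhysics.QuantumFieldTheory.Balaban1983to89.B8SockHFP59Gamma
import HarnessLib

/-!
# `hP1room` PROGRAMME (LEAD-H BOARD v7 «H = SLetτAllL ∧ SB9γAllL», EDITION γ; WORD 17 row (L2γ)'s TOP sibling ∕ V7-5), THE TOP-STEP CALL WITH `λ′` `τ`-FREE, EDITION γ: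
# ✓p648920 `HalvingP1FlatCoreSupplierTopCallTraceFree.topRows_of_datum_traceFree` with its (1.59) in-edge RE-READ IN THE γ CURRENCY — the vacuous b9 socket
# `SB9 : SockB9P3 … (cubeLamB …)` REPLACED by Theorem 4's own two-member (1.59) clause `H59Dβm` over a CLASS-PARAMETRIC datum class `Λb` under PRINT's box law
# «box ⊂ Ω_{j−1}» with the exterior-collar allowance, the source bound served by lit ✓`B8SockHFP59Gamma.grad_bound_of_datum59_γ`

Route `UnitScaleTilt`, crux K1 child «MinimiserStabilityRegPr» (stmt-QuantumFields-19200), registered stub `stub_halvingStep` (`BirthV10`).  Cell `ym3-torus` (HUMAN RULING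
D-0037: YM₃ on T³ is ladder rung R3 — NOT d = 4, NOT a mass gap, NOT the Clay problem), width seat `ym-ust-19200-w3` gen 9.  `--supports stmt-QuantumFields-19200 --as helper`;
THEOREMS ONLY (0 `def`, 0 `sorry`); count-neutral; nothing here claims `core′`, `hP1room`, `hSupU`, the stub, the crux or the gap.

WHY (LEAD-H WORD 13∕14∕15∕17, 2026-08-28).  The b9 socket `SockB9P3` (and its repairs `SockB9P3D4`, `SockB9P3D4β` read at the class `cubeLamB`) is KERNEL-VACUOUS at the cell's cube
members (lit certificates ✓`B9SupplySockB9P3ZdSocketBoundaryMode.not_sockB9P3D4_cube`, ✓`B8Ineq159FlatShellModeVacuity`, ★w7-19200 g6's `…HSB9AllNotAtCubeMember`): the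
SideTouches-at-finite-`Ω₀` LHS counts collar∕shell bonds the averaging datum over a «box ⊂ Ω_j» class cannot see.  pub-ymgap's edition of record is γ (lit ✓`B9SupplySockB9P3ZdGamma`,
✓`B8Eq142KLevelLocalGamma`, ✓`B8Thm4KLevelGamma`, ✓`B8SockHFP59Gamma`): the β-shaped socket read at PRINT's class (inner AND crossing bonds at every level, [B6] (2.3)), box law
«box ⊂ Ω_{j−1}», the datum's (1.35) in the same guard, [3] Prop. 4's windows one level lower.  THIS FILE is ✓p648920 re-run in that currency.
WHAT.  ★★★ `topRows_of_datum_traceFree_γ` — ✓p648920's binders VERBATIM except: `hbox` ↦ print's law (`… → x ∈ Ω (j − 1)`); `h135` ↦ the same guard; `SB9 hα₀9 hcs9` ↦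
Theorem 4's clause `H59Dβm` for the datum at the flat background (two members, index `Λb m j ∪ {level-0 crossing bonds of Ω₀}`, `+ Bbd·Φ₀(A′)`) + (1.66)₀ `h66` + the
boundary-layer law `hlay` + `{Bbd} (hBbd : 0 ≤ Bbd) (hBd : 4·Bbd ≤ (dL − 1)·B₀)` + the support clause `hu₁S : u₁ = 1 off Ω₀`; `hC₂` ↦ the γ remainder constant
(`… · e^{…L²α₀} · L² ≤ C₂`); PLUS the γ windows `hα3γ hα4γ h16γ hsmallγ hc₃γ` at `(L²α₀, L·c⋆)`.  Proof = ✓p648920's with `grad_bound_of_datum … SB9 …` ↦ lit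
✓`grad_bound_of_datum59_γ … h66 hlay hBbd hBd … hu₁S … h59a h59g`.  CONCLUSION UNCHANGED (✓p648920's eight conjuncts).
A6 GUARD (LEAD rule, WORD 17): `H59Dβm` is CONSUMED here, class-parametric; at the cube member of record with `Λb := cubeLamBP'` it is print's (1.59) ([4] Thm 3.3 for `G(1)` with
exterior data) — OPEN (N06; lit name `Ineq159FlatCubeMemberPrinted`), A6-witnessed at truncation `0` only (lit ✓`B9SupplySockB9P3ZdGamma` ∕ `…nonvacuous_cubeLamBP'_zero`), A6-partial
threshold `B₀ ≥ 1` (lit `B8SockHFP59Gamma` scope (i)); over a «box ⊂ Ω_j» class it is vacuous (p572834) — consumers MUST pass print's class.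
HONEST SCOPE.  By-name plumbing; every analytic∕τ row stays DISPLAYED; nothing of Prop. 5, Theorem 4, [4], `core′` or the stub is proved.  Rung R3, NOT Clay; YM gap NOT proved.

References: T. Bałaban, CMP **99** (1985) 75–102 [Balaban1985RegularSpaces] (Prop. 5 (1.106)–(1.109) p.94, Thm 4 p.88, (1.66)–(1.69) p.88, (1.31) p.82, (1.92)–(1.103) pp.91–93,
Sect. E (1.112)–(1.125) pp.95–97, p.76, p.77); CMP **99** (1985) 389–434 [Balaban1985BackgroundPropagators] (Thm 3.1 p.397, (3.25) p.394, Thm 3.3 p.399, (3.16) p.393);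
CMP **96** (1984) 223–250 [Balaban1984PropagatorsII] ((2.3) p.224); CMP **98** (1985) 17–51 [Balaban1985Averaging] (p.20, (78)–(80) p.30, (208)–(214) p.50).
-/

set_option autoImplicit false

noncomputable section

open scoped BigOperators
open NormedSpace
open Complex (I)

namespace Summit.QuantumFields.YangMills.Theorems.HalvingP1FlatCoreSupplierTopCallTraceFreeGamma

open Literature.MathematicalPhysics.QuantumFieldTheory.Balaban1983to89
open T4Continuum
open MatrixLog (mlog)
open B7Prop1Explicit (e expUnit U1)
open B7Prop2Explicit (unitaryUnits unitaryUnits_le_U1 C0 c2' avgIter)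
open B7Prop3Flat (c3)
open B7Prop10General (C6 C4G)
open B7Prop9Flat (C5')
open B7Prop1Local (InBox pdevOn loK bondHiK)
open B7Eq78Linearization (conjR zdBlocking QprimeIter)
open B7Eq170Flat (cj)
open B7Eq92Concrete (mgauge)
open B8Ineq130 (tlo thi)
open B8Ineq132 (covDerivFwd covDeriv InAk)
open B8Eq119TwistedAxial (Restr129 InAx bgT)
open B8Eq184Proof (gaugeExp cfgExp)
open B8Eq182Proof (gAd)
open B8Eq188Proof (frakF3)
open B8Lemma1NonAbelian (mulCfg)
open B8Eq140Level (SideTouches)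
open B8Eq146AExpansion (iEta)
open B8Thm2LogB (blockTop)
open B8Eq138LandauZd (IsLandau138W covDivB covLap QT)
open B8Ineq125Concrete (C2p C2p_nonneg)
open B8Eq1117Concrete (XSpace)
open B8Eq155JBound (expCfg_iEta_mem_unitaryUnits)
open B8Prop5ContractionKLevel (Bd2 Mc Kc)
open B8LambdaSpaceKLevel (wt)
open B8Eq178Averages (Qnl)
open B8Eq1123Concrete (Cnl)
open B8Prop5SocketDatum (exists_masked_datum grad_bound_of_datum bd2_covDivB_of_grad restr129_succ_of_truncation sideTouches_pair_of_mem
  sideTouches_of_tower_bond h33_of_inAk hP_of_datum h69_of_datum hA_of_datum)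
open B8SockHFPAssembly (isSelfAdjoint_covDivB covDivB_congr_at frakF3_congr_at inAx_mgauge_expCfg_of_datum)
open Literature.MathematicalPhysics.QuantumLattice (blockSites)
open B10Eq27TorusAxialLog (axialT)
open Node00 (coverAt)
open B15Eq112TorusCover (cover)
open LatticeFieldCalculus (siteAvgIter)
open Summit.QuantumFields.YangMills.Theorems.Prop8ChartDoubleBar (dbarIterU)
open Summit.QuantumFields.YangMills.Theorems.P1FlatCoreTopStepTorus (hFP_kLevel_top_RD_traceFree)
open Summit.QuantumFields.YangMills.Theorems.HalvingP1FlatCoreSupplierLowerFamily (lowerFamily_rows lowerFamily_traceRow)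
open B8Prop5JoinSectELocalRDTraceFree (apply_covDivB)
open B8SockHFP59Gamma (grad_bound_of_datum59_γ)
open B8ScaledSupNorm (bondNorm msup)
open B8Eq155JBound (Jcur wsup)
open B7Prop4GeneralLevels (linCovIter)
open B9SupplySockB9P3ZdBeta (CrossB)
open B8Ineq132 (BondTouches)
open B7Prop2Explicit (AvgClosed)

-- `Site` alone could resolve to the torus sites; N05's carriers are `Fin d → ℤ`.
open B7Prop1Explicit (Site)

variable {P : Params} {𝔸 : Type*} [CStarAlgebra 𝔸] [Nontrivial 𝔸]

/-- ★★★ **THE TOP-STEP CALL AT THEOREM 4's INDUCTIVE DATUM WITH `λ′` `τ`-FREE, EDITION γ** — ✓p648920 `topRows_of_datum_traceFree` with the (1.59) in-edge re-read in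
pub-ymgap's currency of record: class-parametric `Λb` under print's box law «box ⊂ Ω_{j−1}», (1.35) in the same guard, Theorem 4's own two-member clause `H59Dβm` (β-shaped index,
exterior-collar allowance) in place of the vacuous `SockB9P3`, (1.66)₀ + boundary-layer law + `B_∂` window + support clause for the collar∕crossing terms, γ windows; source bound by lit
✓`B8SockHFP59Gamma.grad_bound_of_datum59_γ`.  Conclusion = ✓p648920's, unchanged.  See the module docstring (A6 GUARD included).
[cite: Balaban1985RegularSpaces, Prop. 5 (1.106)-(1.109) p.94, Thm 4 p.88, (1.66)-(1.69) p.88, (1.31) p.82, p.76, p.77, (1.112)-(1.125) pp.95-97; Balaban1985BackgroundPropagators, Thm 3.1 p.397, (3.25) p.394, Thm 3.3 p.399, (3.16) p.393; Balaban1984PropagatorsII, (2.3) p.224; Balaban1985Averaging, p.20, (78)-(80) p.30, (208)-(214) p.50] -/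
theorem topRows_of_datum_traceFree_γ (τ : 𝔸 →L[ℂ] ℂ) (hτtr : ∀ x y : 𝔸, τ (x * y) = τ (y * x)) (hd2 : 2 ≤ P.d) (hL : 2 ≤ P.L) {η : ℝ} (hη : 0 < η) {K₀ : ℕ}
    -- the groups of the joint J-SU: `G` (averaging-closed, unitary; the flat background is `G`-valued) `≤ H` (values of `u₁`; (H2), (H3))
    {G H : Subgroup 𝔸ˣ} (hGrp2 : ∀ g ∈ H, ‖(g : 𝔸) - 1‖ ≤ 1 / 8 → τ (mlog (g : 𝔸)) = 0) (hGrp3 : ∀ S : 𝔸, τ S = 0 → expUnit S ∈ H)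
    (hGA : AvgClosed P.d P.L G) (hGH : G ≤ H) (hGu : G ≤ unitaryUnits 𝔸)
    -- the member's geometry
    {Ω : ℕ → Set (Site P.d)} (hΩ : ∀ j, Ω (j + 1) ⊆ Ω j) {Λs : ℕ → ℕ → Set (Site P.d)} {Λb : ℕ → ℕ → Set (Site P.d × Fin P.d)}
    -- PRINT's box law (edition γ): the locality box of a level-`j` datum bond lies in `Ω_{j−1}` ((1.31); level 0: `Ω₀`)
    (hbox : ∀ m, m ≤ K₀ → ∀ j, j ≤ m → ∀ c ∈ Λb m j, ∀ x, InBox (loK P.L j c.1) (bondHiK P.L j c.1 c.2) x → x ∈ Ω (j - 1))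
    (hclass : ∀ m, m ≤ K₀ → ∀ j, j ≤ m → ∀ c ∈ Λb m j,
      (c.1 ∈ Λs m j ∧ c.1 + e c.2 ∈ Λs m j) ∨
      (∃ j', j = j' + 1 ∧ (∀ x, (P.L : ℤ) • c.1 ≤ x → x ≤ (P.L : ℤ) • c.1 + blockTop P.L → x ∈ Λs m j') ∧ c.1 + e c.2 ∈ Λs m j) ∨
      (∃ j', j = j' + 1 ∧ c.1 ∈ Λs m j ∧ (∀ x, (P.L : ℤ) • (c.1 + e c.2) ≤ x → x ≤ (P.L : ℤ) • (c.1 + e c.2) + blockTop P.L → x ∈ Λs m j')))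
    {m : ℕ} (hm1 : 1 ≤ m) (hmk : m < K₀) (hmP : m + 1 ≤ P.m + P.K)
    (htower : ∀ j, j ≤ m + 1 → ∀ y ∈ Λs (m + 1) j, ∀ x, InBox (tlo P.L y j) (thi P.L y j) x → x ∈ Ω j)
    (hlt : ∀ j, j < m → Λs m j = Λs (m + 1) j)
    (htop : ∀ x, x ∈ Λs m m ↔ x ∈ Λs (m + 1) m ∨ ∃ y ∈ Λs (m + 1) (m + 1), x ∈ blockSites P.L y)
    -- the socket's antecedents: constants, (1.33), (1.34), (1.35)/(1.66) for the pre-gauged field `U′` at the flat background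
    {α₀ α₁ B₀ B₀' cs α₄ : ℝ} (hα₀ : 0 < α₀) (hα₁ : 0 < α₁) (hB₀ : 0 < B₀) (hB₀' : 0 < B₀')
    (hcs : cs = 5 * (P.d : ℝ) * P.L * B₀ * (α₀ + α₁)) (hα₄ : α₄ = 8 * B₀' * (5 * (P.d : ℝ) * P.L * B₀) * (α₀ + α₁))
    {U' : Site P.d → Fin P.d → 𝔸ˣ} (hU' : ∀ x κ, U' x κ ∈ unitaryUnits 𝔸)
    (h33 : InAk P.L K₀ η α₀ Ω (1 : Site P.d → Fin P.d → 𝔸ˣ)) (h34 : InAk P.L K₀ η α₀ Ω (mulCfg U' 1))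
    (hAx : ∀ m', m' ≤ K₀ → InAx P.L m' (Λs m') (1 : Site P.d → Fin P.d → 𝔸ˣ) (mulCfg U' 1))
    -- (1.35) for the datum in PRINT's class: every level-`j` bond whose locality box lies in `Ω_{j−1}`
    (h135 : ∀ j, j ≤ K₀ → ∀ (z : Site P.d) (μ : Fin P.d), (∀ x, InBox (loK P.L j z) (bondHiK P.L j z μ) x → x ∈ Ω (j - 1)) →
      ‖(avgIter P.L (mulCfg U' 1) j z μ : 𝔸) - (avgIter P.L (1 : Site P.d → Fin P.d → 𝔸ˣ) j z μ : 𝔸)‖ ≤ α₁)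
    -- (1.66)₀ on the sides touching `Ω₀`, the boundary-layer law of the member's region, the exterior-collar constant with its absorption window
    (h66 : ∀ b ∈ {b : Site P.d × Fin P.d | SideTouches (Ω 0) b.1 b.2}, ‖((U' b.1 b.2 : 𝔸ˣ) : 𝔸) - 1‖ ≤ α₁)
    (hlay : ∀ m, 1 ≤ m → m ≤ K₀ → ∀ y z : Site P.d, y ∈ Ω 0 → z ∉ Ω 0 → (∀ i, y i - 1 ≤ z i ∧ z i ≤ y i + 1) → y ∈ Λs m 0)
    {Bbd : ℝ} (hBbd : 0 ≤ Bbd) (hBd : 4 * Bbd ≤ ((P.d : ℝ) * P.L - 1) * B₀)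
    -- the datum at level `m`
    {u₁ : Site P.d → 𝔸ˣ} {U₁ : Site P.d → Fin P.d → 𝔸ˣ} {A : Site P.d → Fin P.d → 𝔸}
    (hu₁ : ∀ x, u₁ x ∈ unitaryUnits 𝔸) (hu₁H : ∀ x, u₁ x ∈ H) (hu₁S : ∀ x, x ∉ Ω 0 → u₁ x = 1)
    (hW : mgauge (1 : Site P.d → Fin P.d → 𝔸ˣ) u₁ U₁ = U') (h129 : Restr129 P.L m (Λs m) (1 : Site P.d → Fin P.d → 𝔸ˣ) u₁)
    (hLan : IsLandau138W P.L m η (Ω 0) (Λs m) (1 : Site P.d → Fin P.d → 𝔸ˣ) U₁)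
    (hdat : ∀ j, j ≤ m → ∀ b ∈ {b : Site P.d × Fin P.d | SideTouches (Ω j) b.1 b.2},
      U₁ b.1 b.2 = cfgExp η A b.1 b.2 ∧ IsSelfAdjoint (A b.1 b.2) ∧ ‖A b.1 b.2‖ ≤ cs * ((P.L : ℝ) ^ j * η)⁻¹)
    (hAτ : ∀ j, j ≤ m → ∀ b ∈ {b : Site P.d × Fin P.d | SideTouches (Ω j) b.1 b.2}, τ (A b.1 b.2) = 0)
    -- Theorem 4's own TWO-member (1.59) clause for the level-`m` datum at the flat background, EDITION γ∕β-shaped index (`Λb m j` ∪ the level-0 crossing bonds of `Ω₀`),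
    -- WITH THE EXTERIOR-COLLAR ALLOWANCE — [4] Thm 3.3 for `G(1)` on the finite region; print's (1.59) when `Λb` is print's class (`cubeLamBP'`), vacuous over a «box ⊂ Ω_j» class
    (H59Dβm : ∀ A' : Site P.d → Fin P.d → 𝔸, (∀ y τ, IsSelfAdjoint (A' y τ)) →
      (∀ j, j ≤ m → ∀ (y : Site P.d) (τ : Fin P.d), SideTouches (Ω j) y τ →
        U₁ y τ = cfgExp η A' y τ ∧ ‖A' y τ‖ ≤ cs * ((P.L : ℝ) ^ j * η)⁻¹) →
      (∀ (y : Site P.d) (τ : Fin P.d), (∀ j, j ≤ m → ¬ SideTouches (Ω j) y τ) → A' y τ = 0) →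
      msup P.L m η (-(1 : ℝ)) (fun j (b : Site P.d × Fin P.d) => SideTouches (Ω j) b.1 b.2) (fun b => A' b.1 b.2)
          ≤ B₀ * (bondNorm P.L m η (-(3 : ℝ)) Ω (fun x μ => Jcur η (1 : Site P.d → Fin P.d → 𝔸ˣ) A' μ x)
            + wsup 1 (fun p : {p : ℕ × (Site P.d × Fin P.d) // p.1 ≤ m ∧ (p.2 ∈ Λb m p.1 ∨ (p.1 = 0 ∧ CrossB (Ω 0) p.2))} =>
                linCovIter P.L (1 : Site P.d → Fin P.d → 𝔸ˣ) (iEta η A') p.1.1 p.1.2.1 p.1.2.2))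
            + Bbd * msup P.L m η (-(1 : ℝ)) (fun j (b : Site P.d × Fin P.d) => j = 0 ∧ SideTouches (Ω 0) b.1 b.2 ∧ ¬ BondTouches (Ω 0) b.1 b.2)
                (fun b => A' b.1 b.2) ∧
        msup P.L m η (-(2 : ℝ)) (fun j (t : Fin P.d × Fin P.d × Site P.d) => SideTouches (Ω j) t.2.2 t.2.1)
            (fun t => covDerivFwd η (1 : Site P.d → Fin P.d → 𝔸ˣ) t.1 (fun z => A' z t.2.1) t.2.2)
          ≤ B₀ * (bondNorm P.L m η (-(3 : ℝ)) Ω (fun x μ => Jcur η (1 : Site P.d → Fin P.d → 𝔸ˣ) A' μ x)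
            + wsup 1 (fun p : {p : ℕ × (Site P.d × Fin P.d) // p.1 ≤ m ∧ (p.2 ∈ Λb m p.1 ∨ (p.1 = 0 ∧ CrossB (Ω 0) p.2))} =>
                linCovIter P.L (1 : Site P.d → Fin P.d → 𝔸ˣ) (iEta η A') p.1.1 p.1.2.1 p.1.2.2))
            + Bbd * msup P.L m η (-(1 : ℝ)) (fun j (b : Site P.d × Fin P.d) => j = 0 ∧ SideTouches (Ω 0) b.1 b.2 ∧ ¬ BondTouches (Ω 0) b.1 b.2)
                (fun b => A' b.1 b.2))
    -- Proposition 3's windows at `(α₀, α₂ := c⋆)` not implied by the JOIN's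
    {C₂ : ℝ} (hside : 36 * P.d * B₀ * cs ≤ 1 / 2)
    (hC₂ : 8 * (131072 * ((P.d : ℝ) + 1) ^ 2) * Real.exp (4 * (800 * ((P.d : ℝ) + 1) ^ 2 * ((P.d : ℝ) + 4)) * ((P.L : ℝ) ^ 2 * α₀)) * (P.L : ℝ) ^ 2 ≤ C₂)
    (h61 : 2 * cs ^ 2 + 20 * P.d * α₀ * cs + 2 * C₂ * cs ^ 2 ≤ α₀ + α₁) (hsmall₁ : (P.d : ℝ) * P.L * α₁ ≤ 1 / 8)
    -- EDITION γ: [3] Prop. 4's windows ONE LEVEL LOWER, at `(L²α₀, L·c⋆)`, for the (1.42)∕(1.56) steps at the datum bonds (box ⊂ Ω_{j−1})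
    (hα3γ : C0 P.d * ((P.L : ℝ) ^ 2 * α₀) ≤ 1 / 3) (hα4γ : 4 * ((P.L : ℝ) ^ 2 * α₀) ≤ c2' P.d P.L) (h16γ : 16 * ((P.L : ℝ) * cs) ≤ 1)
    (hsmallγ : Real.exp (4 * (800 * ((P.d : ℝ) + 1) ^ 2 * ((P.d : ℝ) + 4)) * ((P.L : ℝ) ^ 2 * α₀))
      * (1 + 8 * (131072 * ((P.d : ℝ) + 1) ^ 2) * ((P.L : ℝ) * cs)) ≤ 2)
    (hc₃γ : 2 * ((P.L : ℝ) * cs) ≤ c3 P.d P.L)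
    -- the [4] LETTERS at `(m + 1, U₀ := 1)`, displayed as the top step reads them
    (g Δ : (Site P.d → 𝔸) →ₗ[ℂ] (Site P.d → 𝔸)) (q : (Site P.d → 𝔸) →ₗ[ℂ] (ℕ → Site P.d → 𝔸)) (qs : (ℕ → Site P.d → 𝔸) →ₗ[ℂ] (Site P.d → 𝔸))
    (Aw c : (ℕ → Site P.d → 𝔸) →ₗ[ℂ] (ℕ → Site P.d → 𝔸))
    (g_rightΩ : ∀ x, ∀ y ∈ Ω 0, (Δ (g x) + qs (Aw (q (g x)))) y = x y)
    (c_range : ∀ f, q (g (g (qs (c (q f))))) = q f)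
    (hΔ : ∀ (f : Site P.d → 𝔸), ∀ x ∈ Ω 0, Δ f x = covLap η (1 : Site P.d → Fin P.d → 𝔸ˣ) ((Ω 0).indicator f) x)
    (hqs : ∀ (μ : ℕ → Site P.d → 𝔸), ∀ x ∈ Ω 0, qs μ x = QT P.L (m + 1) (Λs (m + 1)) (1 : Site P.d → Fin P.d → 𝔸ˣ) μ x)
    (hq : ∀ (f : Site P.d → 𝔸) (j : ℕ), j ≤ m + 1 → ∀ y ∈ Λs (m + 1) j,
      q f j y = QprimeIter (zdBlocking P.d P.L) (bgT P.L (1 : Site P.d → Fin P.d → 𝔸ˣ)) j f y)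
    (H' : XSpace P.d (m + 1) 𝔸 →ₗ[ℂ] (Site P.d → 𝔸)) {B₀'H B₂' BG BR : ℝ} (hB₀'H : 0 < B₀'H) (hB₂' : 0 ≤ B₂') (hBG : 0 ≤ BG) (hBR : 0 ≤ BR)
    (hH0 : ∀ (X : XSpace P.d (m + 1) 𝔸) (x : Site P.d), ‖H' X x‖ ≤ B₀'H * ‖X‖)
    (hH1 : ∀ j, j ≤ m + 1 → ∀ (X : XSpace P.d (m + 1) 𝔸), ∀ p ∈ {b : Site P.d × Fin P.d | SideTouches (Ω j) b.1 b.2},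
      wt P.L η j * ‖covDerivFwd η (1 : Site P.d → Fin P.d → 𝔸ˣ) p.2 (H' X) p.1‖ ≤ B₀'H * ‖X‖)
    (hH2 : ∀ X : XSpace P.d (m + 1) 𝔸, Bd2 P.L η (m + 1) Ω (covLap η (1 : Site P.d → Fin P.d → 𝔸ˣ) (H' X)) (B₂' * ‖X‖))
    (hHsupp : ∀ (X : XSpace P.d (m + 1) 𝔸) (x : Site P.d), x ∉ Ω 0 → H' X x = 0)
    (hHequiv : ∀ X Y : XSpace P.d (m + 1) 𝔸, (∀ p, Y p = -star (X p)) → ∀ x, H' Y x = -star (H' X x))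
    (hQH : ∀ (Y : XSpace P.d (m + 1) 𝔸) (j : ℕ) (hj : j ≤ m + 1) (y : Site P.d), y ∈ Λs (m + 1) j →
      QprimeIter (zdBlocking P.d P.L) (bgT P.L (1 : Site P.d → Fin P.d → 𝔸ˣ)) j (H' Y) y = Y (⟨j, Nat.lt_succ_of_le hj⟩, y))
    (hG : ∀ (f : Site P.d → 𝔸) (r : ℝ), 0 ≤ r → Bd2 P.L η (m + 1) Ω f r →
      (∀ x, ‖g f x‖ ≤ BG * r) ∧ ∀ j, j ≤ m + 1 → ∀ p ∈ {b : Site P.d × Fin P.d | SideTouches (Ω j) b.1 b.2},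
        wt P.L η j * ‖covDerivFwd η (1 : Site P.d → Fin P.d → 𝔸ˣ) p.2 (g f) p.1‖ ≤ BG * r)
    (hGsupp : ∀ (f : Site P.d → 𝔸) (x : Site P.d), x ∉ Ω 0 → g f x = 0)
    (hGreal : ∀ f : Site P.d → 𝔸, (∀ j, j ≤ m + 1 → ∀ x ∈ Ω j, IsSelfAdjoint (f x)) → ∀ x, IsSelfAdjoint (g f x))
    (hRbd : ∀ (f : Site P.d → 𝔸) (r : ℝ), 0 ≤ r → Bd2 P.L η (m + 1) Ω f r → Bd2 P.L η (m + 1) Ω (f - g (qs (c (q (g f))))) (BR * r))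
    (hRreal : ∀ f : Site P.d → 𝔸, (∀ j, j ≤ m + 1 → ∀ x ∈ Ω j, IsSelfAdjoint (f x)) →
      ∀ j, j ≤ m + 1 → ∀ x ∈ Ω j, IsSelfAdjoint ((f - g (qs (c (q (g f))))) x))
    -- the letters' `τ`-compatibility (joint J-SU)
    (hHτ : ∀ X : XSpace P.d (m + 1) 𝔸, (∀ p, τ (X p) = 0) → ∀ x, τ (H' X x) = 0)
    (hGτ : ∀ f : Site P.d → 𝔸, (∀ j, j ≤ m + 1 → ∀ x ∈ Ω j, τ (f x) = 0) → ∀ x, τ (g f x) = 0)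
    (hRτ : ∀ f : Site P.d → 𝔸, (∀ j, j ≤ m + 1 → ∀ x ∈ Ω j, τ (f x) = 0) →
      ∀ j, j ≤ m + 1 → ∀ x ∈ Ω j, τ ((f - g (qs (c (q (g f))))) x) = 0)
    -- the JOIN's scalar windows (the lower family's, N05's letters; `cB cA cDA` free above their datum values)
    {cB cA cDA : ℝ} (hcBlo : P.L * cs ≤ cB) (hcAlo : P.L * cs ≤ cA) (hcDAlo : (P.d : ℝ) * (P.L : ℝ) ^ 2 * cs ≤ cDA)
    (hα3 : C0 P.d * α₀ ≤ 1 / 3) (hα4 : 4 * α₀ ≤ c2' P.d P.L)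
    (hsmall : Real.exp (4 * (800 * ((P.d : ℝ) + 1) ^ 2 * ((P.d : ℝ) + 4)) * α₀) * (1 + 8 * (131072 * ((P.d : ℝ) + 1) ^ 2) * cB) ≤ 2)
    (hc₃ : 2 * cB ≤ c3 P.d P.L) (hsc : 2048 * (P.d : ℝ) * cB ≤ 1) (hα₃' : 40 * P.d * cB ≤ 1 / 200)
    (hs₁ : 200 * C6 P.d * (2 * α₄) ≤ 1) (hs₂ : 12000 * ((P.d : ℝ) + 1) * P.L * (2 * α₄) ≤ 1)
    (hs₃ : C4G P.d P.L * (α₀ + 40 * P.d * cB + 4 * (2 * α₄)) ≤ 1)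
    (hs₄ : 1024 * ((P.d : ℝ) + 1) * ((P.d : ℝ) + 4) * P.L ^ 2 * α₀ ≤ 1) (hs₅ : 32 * ((P.d : ℝ) + 1) ^ 2 * C6 P.d * P.L ^ 2 * α₀ ≤ 1)
    (hs₆ : 16 * P.d * C5' P.d * C6 P.d * (P.L : ℝ) ^ 2 * α₀ ≤ 1) (hs₇ : 8 * P.d * C6 P.d * P.L * α₀ ≤ 1)
    (hprod8 : 2 * C6 P.d * (40 * P.d * cB + 4 * α₄) ≤ 1 / 8) (hcA' : cA ≤ 1 / 13)
    -- the family constants of the top step: above the lower family's; the top member's are the torus windows' business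
    {Cb Cl : ℝ} (hCblo : C2p P.d * (40 * P.d * cB + α₄) * α₄ ≤ Cb) (hCllo : 2 * C2p P.d * (40 * P.d * cB + 2 * α₄) ≤ Cl)
    (hCbρ : Cb ≤ α₄ / (2 * B₀'H)) (hClB : Cl * B₀'H ≤ 1 / 2)
    -- (D) the torus side: the effective-gauge tower of the charted iterate, the representative, the target (✓p636261's letters VERBATIM at `k := m + 1`)
    (W₁ : GaugeField P 0 𝔸ˣ) (κf : (Literature.MathematicalPhysics.QuantumFieldTheory.Balaban1983to89.Site P 0 → 𝔸) → (i : ℕ) → GaugeTransf P i 𝔸ˣ)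
    (rep : Literature.MathematicalPhysics.QuantumFieldTheory.Balaban1983to89.Site P 0 → Site P.d)
    (hrep : ∀ yc ∈ Λs (m + 1) (m + 1), ∀ x : Site P.d, InBox (tlo P.L yc (m + 1)) (thi P.L yc (m + 1)) x → rep (cover P x) = x)
    (y₀ : Literature.MathematicalPhysics.QuantumFieldTheory.Balaban1983to89.Site P (m + 1))
    (th : XSpace P.d (m + 1) 𝔸) (hτ : B₀'H * ‖th‖ < α₄ / 4) (hth : ∀ p, star (th p) = -th p)
    (hthk : ∀ yc ∈ Λs (m + 1) (m + 1), th (⟨m + 1, Nat.lt_succ_self (m + 1)⟩, yc) = mlog ((axialT (dbarIterU (m + 1) W₁) y₀ (coverAt P (m + 1) yc) : 𝔸ˣ) : 𝔸))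
    (hthlo : ∀ (j : ℕ) (hj : j < m + 1) (y : Site P.d), y ∈ Λs (m + 1) j → th (⟨j, Nat.lt_succ_of_lt hj⟩, y) = 0)
    (haxT : ∀ yc ∈ Λs (m + 1) (m + 1), ‖((axialT (dbarIterU (m + 1) W₁) y₀ (coverAt P (m + 1) yc) : 𝔸ˣ) : 𝔸) - 1‖ < 1)
    -- the top-step windows at the Sect. E sizes (✓p636261's letters VERBATIM, `B₀' := B₀'H`)
    (ha₁' : α₄ / 4 + B₀'H * (Cb + ‖th‖) ≤ 1 / 24) (hb₁' : α₄ / 4 + B₀'H * (Cb + ‖th‖) ≤ 1 / 140)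
    (hθ : 10 * (α₄ / 4 + B₀'H * (Cb + ‖th‖)) * BR ≤ 1 / 2) (hh₀' : B₀'H * (Cb + ‖th‖) ≤ 3 * α₄ / 4)
    (h103 : BG * Mc P.d BR (α₄ / 4 + B₀'H * (Cb + ‖th‖)) cA (B₂' * (Cb + ‖th‖)) cDA ≤ α₄ / 4)
    (h106 : BG * Kc P.d BR (α₄ / 4 + B₀'H * (Cb + ‖th‖)) cA (B₂' * (Cb + ‖th‖)) cDA (B₂' * (2 * Cl)) (1 + B₀'H * (2 * Cl)) (1 + B₀'H * (2 * Cl))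
      ≤ 1 / 2)
    -- (E) the three top rows in torus letters on the tower box (✓p636261's letters VERBATIM at `k := m + 1`)
    (hTop121 : ∀ yc ∈ Λs (m + 1) (m + 1), ∀ l₀ : Literature.MathematicalPhysics.QuantumFieldTheory.Balaban1983to89.Site P 0 → 𝔸,
      (∀ x : Site P.d, InBox (tlo P.L yc (m + 1)) (thi P.L yc (m + 1)) x → ‖l₀ (cover P x)‖ ≤ α₄) →
      (∀ (x : Site P.d) (κ : Fin P.d), InBox (tlo P.L yc (m + 1)) (thi P.L yc (m + 1)) x → InBox (tlo P.L yc (m + 1)) (thi P.L yc (m + 1)) (x + e κ) →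
        ‖l₀ (cover P (x + e κ)) - l₀ (cover P x)‖ ≤ α₄ * ((P.L : ℝ) ^ (m + 1))⁻¹) →
      exp (mlog ((κf l₀ (m + 1) (coverAt P (m + 1) yc) : 𝔸ˣ) : 𝔸)) = ((κf l₀ (m + 1) (coverAt P (m + 1) yc) : 𝔸ˣ) : 𝔸) ∧
        ‖mlog ((κf l₀ (m + 1) (coverAt P (m + 1) yc) : 𝔸ˣ) : 𝔸) - siteAvgIter (m + 1) l₀ (coverAt P (m + 1) yc)‖ ≤ Cb)
    (hTop125 : ∀ yc ∈ Λs (m + 1) (m + 1), ∀ (l₁ l₂ : Literature.MathematicalPhysics.QuantumFieldTheory.Balaban1983to89.Site P 0 → 𝔸) (r : ℝ), 0 ≤ r →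
      (∀ x : Site P.d, InBox (tlo P.L yc (m + 1)) (thi P.L yc (m + 1)) x → ‖l₁ (cover P x)‖ ≤ α₄) →
      (∀ (x : Site P.d) (κ : Fin P.d), InBox (tlo P.L yc (m + 1)) (thi P.L yc (m + 1)) x → InBox (tlo P.L yc (m + 1)) (thi P.L yc (m + 1)) (x + e κ) →
        ‖l₁ (cover P (x + e κ)) - l₁ (cover P x)‖ ≤ α₄ * ((P.L : ℝ) ^ (m + 1))⁻¹) →
      (∀ x : Site P.d, InBox (tlo P.L yc (m + 1)) (thi P.L yc (m + 1)) x → ‖l₂ (cover P x)‖ ≤ α₄) →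
      (∀ (x : Site P.d) (κ : Fin P.d), InBox (tlo P.L yc (m + 1)) (thi P.L yc (m + 1)) x → InBox (tlo P.L yc (m + 1)) (thi P.L yc (m + 1)) (x + e κ) →
        ‖l₂ (cover P (x + e κ)) - l₂ (cover P x)‖ ≤ α₄ * ((P.L : ℝ) ^ (m + 1))⁻¹) →
      (∀ x : Site P.d, InBox (tlo P.L yc (m + 1)) (thi P.L yc (m + 1)) x → ‖l₁ (cover P x) - l₂ (cover P x)‖ ≤ r) →
      (∀ (x : Site P.d) (κ : Fin P.d), InBox (tlo P.L yc (m + 1)) (thi P.L yc (m + 1)) x → InBox (tlo P.L yc (m + 1)) (thi P.L yc (m + 1)) (x + e κ) →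
        ‖(l₁ (cover P (x + e κ)) - l₂ (cover P (x + e κ))) - (l₁ (cover P x) - l₂ (cover P x))‖ ≤ r * ((P.L : ℝ) ^ (m + 1))⁻¹) →
      ‖(mlog ((κf l₁ (m + 1) (coverAt P (m + 1) yc) : 𝔸ˣ) : 𝔸) - siteAvgIter (m + 1) l₁ (coverAt P (m + 1) yc)) -
          (mlog ((κf l₂ (m + 1) (coverAt P (m + 1) yc) : 𝔸ˣ) : 𝔸) - siteAvgIter (m + 1) l₂ (coverAt P (m + 1) yc))‖ ≤ Cl * r)
    (hTopReal : ∀ yc ∈ Λs (m + 1) (m + 1), ∀ l₀ : Literature.MathematicalPhysics.QuantumFieldTheory.Balaban1983to89.Site P 0 → 𝔸,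
      (∀ x : Site P.d, InBox (tlo P.L yc (m + 1)) (thi P.L yc (m + 1)) x → ‖l₀ (cover P x)‖ ≤ α₄) →
      (∀ (x : Site P.d) (κ : Fin P.d), InBox (tlo P.L yc (m + 1)) (thi P.L yc (m + 1)) x → InBox (tlo P.L yc (m + 1)) (thi P.L yc (m + 1)) (x + e κ) →
        ‖l₀ (cover P (x + e κ)) - l₀ (cover P x)‖ ≤ α₄ * ((P.L : ℝ) ^ (m + 1))⁻¹) →
      mlog ((κf (fun s => -star (l₀ s)) (m + 1) (coverAt P (m + 1) yc) : 𝔸ˣ) : 𝔸) - siteAvgIter (m + 1) (fun s => -star (l₀ s)) (coverAt P (m + 1) yc) =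
        -star (mlog ((κf l₀ (m + 1) (coverAt P (m + 1) yc) : 𝔸ˣ) : 𝔸) - siteAvgIter (m + 1) l₀ (coverAt P (m + 1) yc)))
    -- (τ) the torus τ-rows of (τ-3): the target and the top member (suppliers ✓`…TopTargetTrace`, ✓`…TopRowsTrace`)
    (hthτ : ∀ p, τ (th p) = 0)
    (hTopTrace : ∀ yc ∈ Λs (m + 1) (m + 1), ∀ l₀ : Literature.MathematicalPhysics.QuantumFieldTheory.Balaban1983to89.Site P 0 → 𝔸, (∀ s, τ (l₀ s) = 0) →
      (∀ x : Site P.d, InBox (tlo P.L yc (m + 1)) (thi P.L yc (m + 1)) x → ‖l₀ (cover P x)‖ ≤ α₄) →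
      (∀ (x : Site P.d) (κ : Fin P.d), InBox (tlo P.L yc (m + 1)) (thi P.L yc (m + 1)) x → InBox (tlo P.L yc (m + 1)) (thi P.L yc (m + 1)) (x + e κ) →
        ‖l₀ (cover P (x + e κ)) - l₀ (cover P x)‖ ≤ α₄ * ((P.L : ℝ) ^ (m + 1))⁻¹) →
      τ (mlog ((κf l₀ (m + 1) (coverAt P (m + 1) yc) : 𝔸ˣ) : 𝔸) - siteAvgIter (m + 1) l₀ (coverAt P (m + 1) yc)) = 0) :
    ∃ lam : Site P.d → 𝔸, (∀ x, IsSelfAdjoint (lam x)) ∧ (∀ x, x ∉ Ω 0 → lam x = 0) ∧ (∀ x, τ (lam x) = 0) ∧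
      (∀ j, j ≤ m + 1 → ∀ b ∈ {b : Site P.d × Fin P.d | SideTouches (Ω j) b.1 b.2},
        ‖lam b.1‖ ≤ α₄ ∧ wt P.L η j * ‖covDerivFwd η (1 : Site P.d → Fin P.d → 𝔸ˣ) b.2 lam b.1‖ ≤ α₄) ∧
      (∃ μ : ℕ → Site P.d → 𝔸, ∀ x ∈ Ω 0,
        covLap η (1 : Site P.d → Fin P.d → 𝔸ˣ) ((Ω 0).indicator fun y =>
          covDivB η (1 : Site P.d → Fin P.d → 𝔸ˣ) A y + covLap η (1 : Site P.d → Fin P.d → 𝔸ˣ) lam y +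
          ((conjR (gaugeExp lam y)⁻¹ (covDivB η (1 : Site P.d → Fin P.d → 𝔸ˣ) A y) - covDivB η (1 : Site P.d → Fin P.d → 𝔸ˣ) A y) +
            (gAd (covLap η (1 : Site P.d → Fin P.d → 𝔸ˣ) lam y) (lam y) - covLap η (1 : Site P.d → Fin P.d → 𝔸ˣ) lam y) +
            ∑ μ, frakF3 η (1 : Site P.d → Fin P.d → 𝔸ˣ) lam A y μ)) x = QT P.L (m + 1) (Λs (m + 1)) (1 : Site P.d → Fin P.d → 𝔸ˣ) μ x) ∧
      (∀ j, j < m + 1 → ∀ y ∈ Λs (m + 1) j,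
        Qnl P.L (1 : Site P.d → Fin P.d → 𝔸ˣ) (fun x => expUnit (((-I) • lam) x)) u₁⁻¹ j y = 0) ∧
      (∀ yc ∈ Λs (m + 1) (m + 1), κf (((-I) • lam) ∘ rep) (m + 1) (coverAt P (m + 1) yc) = axialT (dbarIterU (m + 1) W₁) y₀ (coverAt P (m + 1) yc)) ∧
      (∀ x ∈ Ω 0, ∀ μ : Fin P.d,
        wt P.L η 0 * ‖A x μ‖ ≤ cA ∧ wt P.L η 0 * ‖conjR ((1 : Site P.d → Fin P.d → 𝔸ˣ) (x - e μ) μ)⁻¹ (A (x - e μ) μ)‖ ≤ cA) := by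
  subst hcs
  have hU₀ : ∀ (x : Site P.d) (κ : Fin P.d), (1 : Site P.d → Fin P.d → 𝔸ˣ) x κ ∈ unitaryUnits 𝔸 := fun _ _ => (unitaryUnits 𝔸).one_mem
  have hL1 : 1 ≤ P.L := le_trans (by norm_num) hL
  have hd1 : 1 ≤ P.d := le_trans (by norm_num) hd2
  have hLr : (1 : ℝ) ≤ P.L := by exact_mod_cast hL1
  have hmK : m + 1 ≤ K₀ := hmk
  have hsum : 0 < α₀ + α₁ := add_pos hα₀ hα₁
  have hcs0 : 0 ≤ 5 * (P.d : ℝ) * P.L * B₀ * (α₀ + α₁) := by positivity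
  have hcspos : 0 < 5 * (P.d : ℝ) * P.L * B₀ * (α₀ + α₁) := by positivity
  have hα₄pos : 0 < α₄ := by rw [hα₄]; positivity
  -- `c⋆ ≤ L·c⋆ ≤ cB`, hence Prop. 3's remaining windows from the JOIN's (N05's arithmetic verbatim)
  have hcsB : 5 * (P.d : ℝ) * P.L * B₀ * (α₀ + α₁) ≤ cB := (le_mul_of_one_le_left hcs0 hLr).trans hcBlo
  have hcB0 : 0 ≤ cB := hcs0.trans hcsB
  have hcA0 : 0 ≤ cA := (hcs0.trans (le_mul_of_one_le_left hcs0 hLr)).trans hcAlo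
  have hcDA0 : 0 ≤ cDA := le_trans (by positivity) hcDAlo
  have hd0 : (1 : ℝ) ≤ P.d := by exact_mod_cast hd1
  have hcBsmall : (P.d : ℝ) * cB ≤ 1 / 8000 := by linarith only [hα₃']
  have hdcs : (P.d : ℝ) * (5 * (P.d : ℝ) * P.L * B₀ * (α₀ + α₁)) ≤ 1 / 8000 :=
    (mul_le_mul_of_nonneg_left hcsB (by positivity)).trans hcBsmall
  have hcs8000 : 5 * (P.d : ℝ) * P.L * B₀ * (α₀ + α₁) ≤ 1 / 8000 := (le_mul_of_one_le_left hcs0 hd0).trans hdcs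
  have h50 : 50 * P.d * (5 * (P.d : ℝ) * P.L * B₀ * (α₀ + α₁)) ≤ 1 := by linarith only [hdcs]
  have hd5 : 5 * (5 * (P.d : ℝ) * P.L * B₀ * (α₀ + α₁)) * ((P.d : ℝ) - 1) ≤ 4 := by nlinarith only [hdcs, hcs0]
  have hαP2 : 2 * α₀ ≤ c2' P.d P.L := by linarith only [hα4, hα₀]
  -- the MASKED exponent `A′` of the datum (globally Hermitian, `= A` on the touched bonds)
  obtain ⟨A', hsa, hagree, hWA, hA0⟩ := exists_masked_datum hdat
  have hWA1 : ∀ j, j ≤ m → ∀ (y : Site P.d) (τ : Fin P.d), SideTouches (Ω j) y τ → U₁ y τ = cfgExp η A' y τ :=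
    fun j hj y τ hs => (hWA j hj y τ hs).1
  have h41 : ∀ j, j ≤ m → ∀ (y : Site P.d) (τ : Fin P.d), SideTouches (Ω j) y τ →
      ‖A' y τ‖ ≤ (5 * (P.d : ℝ) * P.L * B₀ * (α₀ + α₁)) * ((P.L : ℝ) ^ j * η)⁻¹ := fun j hj y τ hs => (hWA j hj y τ hs).2
  -- joint J-SU: the masked exponent is `τ`-free everywhere, hence so is its covariant divergence
  have hA'τ : ∀ x κ, τ (A' x κ) = 0 := by
    intro x κ
    by_cases h : ∃ j, j ≤ m ∧ SideTouches (Ω j) x κ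
    · obtain ⟨j, hj, hs⟩ := h
      rw [hagree j hj x κ hs]; exact hAτ j hj (x, κ) hs
    · rw [hA0 x κ (fun j hj hs => h ⟨j, hj, hs⟩), map_zero]
  have hDAτ : ∀ j, j ≤ m + 1 → ∀ x ∈ Ω j, τ (covDivB η (1 : Site P.d → Fin P.d → 𝔸ˣ) A' x) = 0 :=
    fun j _ x _ => apply_covDivB τ hτtr _ hA'τ x
  have hU₀G : ∀ (x : Site P.d) (κ : Fin P.d), (1 : Site P.d → Fin P.d → 𝔸ˣ) x κ ∈ G := fun _ _ => G.one_mem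
  -- the datum binders BY NAME (`B8Prop5SocketDatum` §7, §1, §5), exactly as N05 reads them
  have h33' := h33_of_inAk hL1 hα₀ h33 hmK htower
  have hP' := hP_of_datum hL1 hα₀ hΩ h34 hmK htower hu₁ hW hWA1
  have h69' : ∀ j, j ≤ m + 1 → ∀ y ∈ Λs (m + 1) j, ∀ (x : Site P.d) (κ : Fin P.d), InBox (tlo P.L y j) (thi P.L y j) x →
      InBox (tlo P.L y j) (thi P.L y j) (x + e κ) → ‖iEta η A' x κ‖ ≤ cB * ((P.L : ℝ) ^ j)⁻¹ :=
    fun j hj y hy x κ hx hxe =>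
      (h69_of_datum hd2 hL1 hη hΩ htower hcs0 h41 j hj y hy x κ hx hxe).trans (mul_le_mul_of_nonneg_right hcBlo (by positivity))
  have hA' : ∀ j, j ≤ m + 1 → ∀ x ∈ Ω j, ∀ μ : Fin P.d,
      wt P.L η j * ‖A' x μ‖ ≤ cA ∧ wt P.L η j * ‖conjR ((1 : Site P.d → Fin P.d → 𝔸ˣ) (x - e μ) μ)⁻¹ (A' (x - e μ) μ)‖ ≤ cA := fun j hj x hx μ =>
    ⟨(hA_of_datum hd2 hL1 hη hΩ hU₀ hcs0 h41 j hj x hx μ).1.trans hcAlo, (hA_of_datum hd2 hL1 hη hΩ hU₀ hcs0 h41 j hj x hx μ).2.trans hcAlo⟩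
  have hBu : ∀ (x : Site P.d) (κ : Fin P.d), B8Eq146AExpansion.expCfg (iEta η A') x κ ∈ unitaryUnits 𝔸 := expCfg_iEta_mem_unitaryUnits η hsa
  have hAx' : InAx P.L (m + 1) (Λs (m + 1)) (1 : Site P.d → Fin P.d → 𝔸ˣ)
      (mgauge (1 : Site P.d → Fin P.d → 𝔸ˣ) u₁ (B8Eq146AExpansion.expCfg (iEta η A')) * (1 : Site P.d → Fin P.d → 𝔸ˣ)) :=
    inAx_mgauge_expCfg_of_datum hd2 hL1 hΩ htower hW hWA1 (hAx (m + 1) hmK)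
  have h129' : Restr129 P.L (m + 1) (Λs (m + 1)) (1 : Site P.d → Fin P.d → 𝔸ˣ) u₁ := restr129_succ_of_truncation hL1 hlt htop h129
  -- the source `D*A′`: (1.69)'s gradient member by Prop. 3 at level `m`, then `|D*A′|₍₋₂₎ ≤ d·L²·c⋆ ≤ cDA`; Hermitian
  obtain ⟨h59a, h59g⟩ := H59Dβm A' hsa hWA hA0
  have hgrad := grad_bound_of_datum59_γ hd2 hη hL K₀ hU₀ hU' hα₀ hα₁ hcspos hB₀.le hα3γ hα4γ h16γ hd5 hsmallγ hc₃γ hside h50 hC₂ h61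
    hsmall₁ Ω hΩ Λs Λb hbox hclass h33 h34 hAx h135 h66 hlay hBbd hBd hm1 hmk.le hu₁ hu₁S hW h129 hLan hsa hWA hA0 h59a h59g
  have hDA : Bd2 P.L η (m + 1) Ω (fun y => covDivB η (1 : Site P.d → Fin P.d → 𝔸ˣ) A' y) cDA := fun j hj x hx =>
    (bd2_covDivB_of_grad hd2 hL1 hη hΩ hU₀ hcs0 hgrad j hj x hx).trans hcDAlo
  have hDAsa : ∀ j, j ≤ m + 1 → ∀ x ∈ Ω j, IsSelfAdjoint (covDivB η (1 : Site P.d → Fin P.d → 𝔸ˣ) A' x) :=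
    fun j _ x _ => isSelfAdjoint_covDivB hU₀ hsa x
  -- the JOIN's bond classes `Eb j := {b ∣ SideTouches (Ω j) b}` (§6)
  have hEbΩ : ∀ j, j ≤ m + 1 → ∀ x ∈ Ω j, ∀ μ : Fin P.d, (x, μ) ∈ {b : Site P.d × Fin P.d | SideTouches (Ω j) b.1 b.2} ∧
      (x - e μ, μ) ∈ {b : Site P.d × Fin P.d | SideTouches (Ω j) b.1 b.2} := fun j _ x hx μ => sideTouches_pair_of_mem hd2 hx μ
  have hEbT : ∀ j, j ≤ m + 1 → ∀ y ∈ Λs (m + 1) j, ∀ (x : Site P.d) (κ : Fin P.d), InBox (tlo P.L y j) (thi P.L y j) x →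
      InBox (tlo P.L y j) (thi P.L y j) (x + e κ) → (x, κ) ∈ {b : Site P.d × Fin P.d | SideTouches (Ω j) b.1 b.2} :=
    fun j hj y hy x κ hx _ => sideTouches_of_tower_bond hd2 htower hj hy x κ hx
  -- the LOWER FAMILY rows (C) at `(Λs (m+1), U₀ := 1)` from the datum (FILE A), weakened to the top step's `Cb`, `Cl`
  obtain ⟨hC121, hC125, hCreal⟩ := lowerFamily_rows hd1 hL hU₀ (Λs (m + 1)) hα₀ hα3 hα4 hcB0 hα₄pos hα₀ hα3 hαP2 hBu h33' h69' hP' hAx'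
    h129' hsmall hc₃ hsc hα₃' hs₁ hs₂ hs₃ hs₄ hs₅ hs₆ hs₇ hprod8
  have hCτ := lowerFamily_traceRow τ hτtr hGrp2 hGrp3 hd1 hL hGA hGH hGu hU₀G (Λs (m + 1)) hu₁H hα₀ hα3 hα4 hcB0 hα₄pos hα₀ hα3 hαP2 hBu
    h33' h69' hP' hAx' h129' hsmall hc₃ hsc hα₃' hs₁ hs₂ hs₃ hs₄ hs₅ hs₆ hprod8
  have hC2 : 0 ≤ C2p P.d := C2p_nonneg P.d
  have hCb : 0 ≤ Cb := le_trans (by positivity) hCblo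
  have hCl : 0 ≤ Cl := le_trans (by positivity) hCllo
  -- THE TOP STEP WITH `λ′` `τ`-FREE ((τ-3), BY NAME) at `k := m + 1`, `Λs := Λs (m+1)`, `A := A′`
  obtain ⟨lam, hlsa, hloff, hlτ, h108, ⟨μ, hmul⟩, hlo, htopId⟩ := hFP_kLevel_top_RD_traceFree (P := P) (k := m + 1) (Λs := Λs (m + 1))
    (Eb := fun j => {b : Site P.d × Fin P.d | SideTouches (Ω j) b.1 b.2}) (A := A') hmP hη hEbΩ hEbT g Δ q qs Aw c g_rightΩ c_range hΔ hqs H'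
    hα₄pos hB₀'H hB₂' hCb hCl hH0 hH1 hH2 hHsupp hHequiv hCbρ hClB hBG hBR hcA0 hcA' hcDA0 hG hGsupp hGreal hRbd hRreal hDA hDAsa hA' hsa hQH hq u₁
    (fun j hj y hy μ' hb ha => (hC121 j hj.le y hy μ' hb ha).trans hCblo)
    (fun j hj y hy μ₁ μ₂ r hr h1b h1a h2b h2a hmb hma =>
      (hC125 j hj.le y hy μ₁ μ₂ r hr h1b h1a h2b h2a hmb hma).trans (mul_le_mul_of_nonneg_right hCllo hr))
    (fun j hj y hy μ' hb ha => hCreal j hj.le y hy μ' hb ha)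
    W₁ κf rep hrep y₀ th hτ hth hthk hthlo haxT ha₁' hb₁' hθ hh₀' h103 h106 hTop121 hTop125 hTopReal τ hτtr hDAτ hRτ hGτ hHτ hthτ
    (fun j hj y hy μ' hμτ hb ha => hCτ j hj.le y hy μ' hμτ hb ha) hTopTrace
  refine ⟨lam, hlsa, hloff, hlτ, fun j hj b hb => h108 j hj b hb, ⟨μ, fun x hx => ?_⟩, hlo, htopId, fun x hx μ' => ?_⟩
  · -- transport the multiplier clause from `A′` back to `A`: the two agree on the bonds read on `Ω₀`
    have hind : ((Ω 0).indicator fun y => covDivB η (1 : Site P.d → Fin P.d → 𝔸ˣ) A y + covLap η (1 : Site P.d → Fin P.d → 𝔸ˣ) lam y +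
          ((conjR (gaugeExp lam y)⁻¹ (covDivB η (1 : Site P.d → Fin P.d → 𝔸ˣ) A y) - covDivB η (1 : Site P.d → Fin P.d → 𝔸ˣ) A y) +
            (gAd (covLap η (1 : Site P.d → Fin P.d → 𝔸ˣ) lam y) (lam y) - covLap η (1 : Site P.d → Fin P.d → 𝔸ˣ) lam y) +
            ∑ μ, frakF3 η (1 : Site P.d → Fin P.d → 𝔸ˣ) lam A y μ)) =
        ((Ω 0).indicator fun y => covDivB η (1 : Site P.d → Fin P.d → 𝔸ˣ) A' y + covLap η (1 : Site P.d → Fin P.d → 𝔸ˣ) lam y +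
          ((conjR (gaugeExp lam y)⁻¹ (covDivB η (1 : Site P.d → Fin P.d → 𝔸ˣ) A' y) - covDivB η (1 : Site P.d → Fin P.d → 𝔸ˣ) A' y) +
            (gAd (covLap η (1 : Site P.d → Fin P.d → 𝔸ˣ) lam y) (lam y) - covLap η (1 : Site P.d → Fin P.d → 𝔸ˣ) lam y) +
            ∑ μ, frakF3 η (1 : Site P.d → Fin P.d → 𝔸ˣ) lam A' y μ)) := by
      refine Set.indicator_congr fun y hy => ?_
      have h₁ : ∀ ν : Fin P.d, A' y ν = A y ν := fun ν => hagree 0 (Nat.zero_le _) y ν (sideTouches_pair_of_mem hd2 hy ν).1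
      have h₂ : ∀ ν : Fin P.d, A' (y - e ν) ν = A (y - e ν) ν := fun ν => hagree 0 (Nat.zero_le _) (y - e ν) ν (sideTouches_pair_of_mem hd2 hy ν).2
      have h₃ : ∀ ν : Fin P.d, frakF3 η (1 : Site P.d → Fin P.d → 𝔸ˣ) lam A' y ν = frakF3 η (1 : Site P.d → Fin P.d → 𝔸ˣ) lam A y ν :=
        fun ν => frakF3_congr_at η _ lam (h₁ ν) (h₂ ν)
      simp only [covDivB_congr_at η _ h₁ h₂, h₃]
    rw [hind]
    exact hmul x hx
  · -- the level-`0` size row of `A` on `Ω₀` (for ✓`isLandau138W_of_topStepOutput`): `A = A′` on the stars of `Ω₀`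
    have h := hA' 0 (Nat.zero_le _) x hx μ'
    rw [hagree 0 (Nat.zero_le _) x μ' (sideTouches_pair_of_mem hd2 hx μ').1,
      hagree 0 (Nat.zero_le _) (x - e μ') μ' (sideTouches_pair_of_mem hd2 hx μ').2] at h
    exact h

end Summit.QuantumFields.YangMills.Theorems.HalvingP1FlatCoreSupplierTopCallTraceFreeGamma

end
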